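import Mathlib.LinearAlgebra.FreeModule.PID
import Mathlib.RingTheory.Flat.TorsionFree
import Literature.AlgebraicGeometry.Motives.AbelianVarietyLie
import HarnessLib

/-!
# `Hom(A, B)` is torsion-free; freeness from finite generation (Mumford §19, Theorem 3)

Sibling proof file of `Literature.NumberTheory.DiophantineGeometry.AVIsogenyTate`, which records
Theorem 3 of §19 of Mumford's *Abelian Varieties* as the named facts
`AbelianVariety.module_finite_hom A B` (`Hom(A, B)` is finitely generated),
`AbelianVariety.module_free_hom A B` (`Hom(A, B)` is free), `AbelianVariety.finrank_hom_le A B` and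
`AbelianVariety.faltingsTateMap_injective A B`, for abelian varieties `A B` over a field `K`. This
file concerns `module_free_hom`; the other siblings are `AVIsogenyTateProofs`
(`tateModuleMap_injective_of_isIsogeny_holds`), `AVIsogenyTateEndAlgebraProofs` (reductions for
`finiteDimensional_endAlgebra`, which consume `module_free_hom A A` as a hypothesis) and
`AVIsogenyTateFinrankHomProofs` (reductions for `finrank_hom_le`).

## The printed proof (source of the architecture)

Mumford, *Abelian Varieties*, §19, Theorem 3 (read in the parallel account J. S. Milne, *Abelian
Varieties*, in Cornell–Silverman, *Arithmetic Geometry* (1986), §12, Lemma 12.2 and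
Theorem 12.5 with Lemmas 12.6–12.7, held): `Hom(A, B)` is a free abelian group of finite rank
because

1. it is **torsion-free** — `n f = f ∘ [n]_A`, and `[n]_A` (`n ≠ 0`) is an isogeny, hence
   surjective, hence right-cancellable (Mumford §19, first step of the proof of Thm. 3, from §6,
   Application 2; Milne 1986, Lemma 12.2, obtains it from the injectivity of
   `Hom(A, B) → Hom(T_ℓ A, T_ℓ B)`);
2. it is **finitely generated** — the degree is a homogeneous polynomial function of degree
   `2 dim A` on `End⁰(A)` (Mumford §19, Thm. 2; Milne, Prop. 12.4), so for simple `A` a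
   finitely generated `M ⊆ End(A)` is discrete in `ℚM` and `ℤ_ℓ ⊗ M → End(T_ℓ A)` is injective
   (Milne, Lemma 12.7), whence `rank ≤ 4 (dim A)²` and finite generation; the general case by
   Poincaré's complete reducibility theorem applied to `End(A × B)` (Milne, Prop. 12.1 and
   p. 147);
3. a finitely generated torsion-free abelian group is free.

Step 2 is the content of the named fact `module_finite_hom` and is **not** proved here (it needs
the theorem of the cube, intersection degrees and Poincaré reducibility, i.e. the dual abelian
variety, none of which the tree has). This file proves step 1 and step 3:

* `AbelianVariety.eq_zero_of_zsmul_eq_zero_of_isIsogeny`: if `[n]_A` is an isogeny and `n f = 0`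
  then `f = 0` — the printed step 1, from `IsIsogeny.epi` (`AVIsogenyQuasiInverse`);
* `AbelianVariety.eq_zero_of_zsmul_eq_zero_of_cast_ne_zero`: **unconditionally**,
  `n f = 0 → f = 0` for every integer `n` that is non-zero in `K`, because `[n]_A` is then an
  isogeny (`isIsogeny_zsmul_id_of_cast_ne_zero`, Görtz–Wedhorn II, Prop. 27.187, proved in
  `AbelianVarietyLie`); so `Hom(A, B)` has no `ℓ`-torsion for primes `ℓ ≠ char K`, and in
  characteristic zero it is torsion-free outright (`isTorsionFree_int_hom_of_charZero`,
  `isAddTorsionFree_hom_of_charZero`) and `End(A) → End⁰(A)` is injective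
  (`endAlgebra.of_injective_of_charZero`, the claim left unproved in the docstring of
  `AbelianVariety.endAlgebra.of`);
* `AbelianVariety.isTorsionFree_int_hom_of_isIsogeny_zsmul_id`: torsion-freeness in every
  characteristic under the named fact `isIsogeny_zsmul_id A` of `AbelianVarietyTorsion`
  (`[n]_A` is an isogeny for all `n ≠ 0`; Görtz–Wedhorn II, Prop. 27.186, theorem of the cube);
* `AbelianVariety.module_free_hom_of_module_finite_hom_of_isIsogeny_zsmul_id` and, for
  `char K = 0`, `AbelianVariety.module_free_hom_of_module_finite_hom`: the named fact
  `module_free_hom A B` follows from `module_finite_hom A B` (and, in characteristic `p > 0`, from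
  `isIsogeny_zsmul_id A`) by step 3, which is Mathlib's `Module.free_of_finite_type_torsion_free'`
  (finitely generated torsion-free modules over a PID are free).

So the discharge `module_free_hom_holds` is *reduced* to `module_finite_hom_holds` (and to
`isIsogeny_zsmul_id_holds` in positive characteristic). No named fact is introduced here.

## Mathlib

Used: `Preadditive.zsmul_comp`, `cancel_epi`, `Limits.comp_zero`, `Module.IsTorsionFree`
(`IsTorsionFree.of_smul_eq_zero`, `IsAddTorsionFree.of_isTorsionFree`),
`Module.free_of_finite_type_torsion_free'`, the instance `Flat ℤ M` for torsion-free `M` over a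
Dedekind domain (`Mathlib.RingTheory.Flat.TorsionFree`) and
`Algebra.TensorProduct.includeRight_injective`. Mathlib has no abelian varieties
(`lean search 'module_free_hom|isTorsionFree_int_hom'`: only the tree's files).

## References

* [MumfordAV1970] D. Mumford, *Abelian Varieties* (1970), §19, Theorem 3 and its proof (first
  step: `Hom(X, Y)` is torsion-free since `n_X` is an isogeny), Corollary 1; §6, Application 2
  (`n_X` is an isogeny). Not held; locators as cited in `AVIsogenyTate`.
* [Milne1986AbelianVarieties] J. S. Milne, *Abelian Varieties*, in G. Cornell, J. H. Silverman
  (eds.), *Arithmetic Geometry*, Springer 1986, §12: Lemma 12.2 ("in particular, `Hom(A, B)` is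
  torsion free"), Prop. 12.4, Theorem 12.5 ("`Hom(A, B)` is a free `ℤ`-module of finite rank
  `≤ 4 dim A dim B`"), Lemmas 12.6–12.7 (held: `book:cornellnd-arithmetic-geometry`, chunks
  189–192).
* [GortzWedhorn2023] U. Görtz, T. Wedhorn, *Algebraic Geometry II* (2023), Prop. 27.186–27.187
  (as cited in `AbelianVarietyTorsion`, `AbelianVarietyLie`).
-/

universe u

open CategoryTheory

noncomputable section

namespace Literature.NumberTheory.DiophantineGeometry

section AbelianVariety
open Literature.AlgebraicGeometry.Motives (AbelianVariety)
open Literature.AlgebraicGeometry.Motives.AbelianVariety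

variable {K : Type u} [Field K] {A B : AbelianVariety K}

/-! ### Step 1: `Hom(A, B)` is torsion-free -/

/-- `n f = [n]_A` followed by `f`: `n • f = (n • 𝟙 A) ≫ f` in the preadditive category of abelian
varieties (Mumford §19, proof of Thm. 3: "`n f = f ∘ n_X`"; Mathlib `Preadditive.zsmul_comp`).
[folklore] -/
theorem _root_.Literature.AlgebraicGeometry.Motives.AbelianVariety.zsmul_eq_zsmul_id_comp
    (n : ℤ) (f : A ⟶ B) : n • f = (n • 𝟙 A) ≫ f := by
  rw [Preadditive.zsmul_comp, Category.id_comp]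

/-- `n f = f` followed by `[n]_B`: `n • f = f ≫ (n • 𝟙 B)` (Mathlib `Preadditive.comp_zsmul`).
[folklore] -/
theorem _root_.Literature.AlgebraicGeometry.Motives.AbelianVariety.zsmul_eq_comp_zsmul_id
    (n : ℤ) (f : A ⟶ B) : n • f = f ≫ (n • 𝟙 B) := by
  rw [Preadditive.comp_zsmul, Category.comp_id]

/-- **Step 1 of Mumford's proof of §19, Theorem 3.** If `[n]_A` is an isogeny and `n f = 0` for a
homomorphism `f : A → B`, then `f = 0`: `n f = f ∘ [n]_A` and an isogeny is surjective, hence an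
epimorphism (`IsIsogeny.epi`, Görtz–Wedhorn II, Prop. 27.178 (1)). (Mumford, *Abelian
Varieties*, §19, proof of Theorem 3, first step; Milne 1986, Lemma 12.2.)
[cite: MumfordAV1970, §19 Thm. 3 (proof, first step)] -/
theorem _root_.Literature.AlgebraicGeometry.Motives.AbelianVariety.eq_zero_of_zsmul_eq_zero_of_isIsogeny
    {n : ℤ} (hn : IsIsogeny (n • 𝟙 A)) {f : A ⟶ B} (h : n • f = 0) : f = 0 := by
  haveI := hn.epi
  have h' : (n • 𝟙 A) ≫ f = (n • 𝟙 A) ≫ 0 := by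
    rw [← zsmul_eq_zsmul_id_comp, h, Limits.comp_zero]
  exact (cancel_epi _).mp h'

/-- **`Hom(A, B)` has no `n`-torsion for `n` invertible in `K`** (unconditional): if `(n : K) ≠ 0`
and `n f = 0` then `f = 0`, because `[n]_A` is then an isogeny
(`isIsogeny_zsmul_id_of_cast_ne_zero`, Görtz–Wedhorn II, Prop. 27.187) and Step 1 applies. In
particular `Hom(A, B)` has no `ℓ`-torsion for every prime `ℓ ≠ char K` (Milne 1986, Lemma 12.2:
"in particular, `Hom(A, B)` is torsion free"; Mumford §19, Thm. 3).
[cite: Milne1986AbelianVarieties, §12 Lemma 12.2] -/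
theorem _root_.Literature.AlgebraicGeometry.Motives.AbelianVariety.eq_zero_of_zsmul_eq_zero_of_cast_ne_zero
    {n : ℤ} (hn : (n : K) ≠ 0) {f : A ⟶ B} (h : n • f = 0) : f = 0 :=
  eq_zero_of_zsmul_eq_zero_of_isIsogeny (isIsogeny_zsmul_id_of_cast_ne_zero n hn) h

/-- Natural-number form of `eq_zero_of_zsmul_eq_zero_of_cast_ne_zero`: if `(n : K) ≠ 0` and
`n f = 0` (`n : ℕ`) then `f = 0` (Milne 1986, Lemma 12.2). [cite: Milne1986AbelianVarieties, §12 Lemma 12.2] -/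
theorem _root_.Literature.AlgebraicGeometry.Motives.AbelianVariety.eq_zero_of_nsmul_eq_zero_of_cast_ne_zero
    {n : ℕ} (hn : (n : K) ≠ 0) {f : A ⟶ B} (h : n • f = 0) : f = 0 :=
  eq_zero_of_zsmul_eq_zero_of_cast_ne_zero (n := n) (by exact_mod_cast hn)
    (by rwa [natCast_zsmul])

/-- **`Hom(A, B)` is torsion-free, given that every `[n]_A` (`n ≠ 0`) is an isogeny.** Under the
named fact `isIsogeny_zsmul_id A` (Görtz–Wedhorn II, Prop. 27.186; Mumford §6, Application 2 —
theorem of the cube), `Hom(A, B)` is a torsion-free `ℤ`-module: this is exactly the first step of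
Mumford's proof of §19, Theorem 3. [cite: MumfordAV1970, §19 Thm. 3 (proof, first step)] -/
theorem _root_.Literature.AlgebraicGeometry.Motives.AbelianVariety.isTorsionFree_int_hom_of_isIsogeny_zsmul_id
    (h₀ : isIsogeny_zsmul_id A) : Module.IsTorsionFree ℤ (A ⟶ B) :=
  Module.IsTorsionFree.of_smul_eq_zero fun n _ h ↦
    (eq_or_ne n 0).imp_right fun hn ↦ eq_zero_of_zsmul_eq_zero_of_isIsogeny (h₀ n hn) h

/-- **In characteristic zero `Hom(A, B)` is torsion-free** (unconditional): every `[n]_A`, `n ≠ 0`,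
is an isogeny (`isIsogeny_zsmul_id_holds_of_charZero`, Görtz–Wedhorn II, Prop. 27.187), so the
first step of Mumford's proof of §19, Theorem 3 goes through (Milne 1986, Lemma 12.2).
[cite: MumfordAV1970, §19 Thm. 3 (proof, first step)] -/
theorem _root_.Literature.AlgebraicGeometry.Motives.AbelianVariety.isTorsionFree_int_hom_of_charZero
    [CharZero K] : Module.IsTorsionFree ℤ (A ⟶ B) :=
  isTorsionFree_int_hom_of_isIsogeny_zsmul_id isIsogeny_zsmul_id_holds_of_charZero

/-- In characteristic zero the additive group `Hom(A, B)` is torsion-free (`n • f = 0`, `n ≠ 0`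
implies `f = 0`; Mumford §19, Thm. 3, first step of the proof; Milne 1986, Lemma 12.2), in
Mathlib's `IsAddTorsionFree` spelling. [cite: MumfordAV1970, §19 Thm. 3 (proof, first step)] -/
theorem _root_.Literature.AlgebraicGeometry.Motives.AbelianVariety.isAddTorsionFree_hom_of_charZero
    [CharZero K] : IsAddTorsionFree (A ⟶ B) :=
  haveI := isTorsionFree_int_hom_of_charZero (A := A) (B := B)
  IsAddTorsionFree.of_isTorsionFree ℤ (A ⟶ B)

/-- Under `isIsogeny_zsmul_id A`, the additive group `Hom(A, B)` is torsion-free in every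
characteristic (Mumford §19, Thm. 3, first step of the proof). [cite: MumfordAV1970, §19 Thm. 3 (proof, first step)] -/
theorem _root_.Literature.AlgebraicGeometry.Motives.AbelianVariety.isAddTorsionFree_hom_of_isIsogeny_zsmul_id
    (h₀ : isIsogeny_zsmul_id A) : IsAddTorsionFree (A ⟶ B) :=
  haveI := isTorsionFree_int_hom_of_isIsogeny_zsmul_id (B := B) h₀
  IsAddTorsionFree.of_isTorsionFree ℤ (A ⟶ B)

/-! ### `End(A) → End⁰(A)` is injective -/

/-- **`End(A) → End⁰(A) = ℚ ⊗ End(A)` is injective when `End(A)` is torsion-free**, here under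
`isIsogeny_zsmul_id A`: a torsion-free abelian group is flat over `ℤ`, so `φ ↦ 1 ⊗ φ` is
injective (Mathlib `Algebra.TensorProduct.includeRight_injective`). This is the injectivity
asserted, but not proved, in the docstring of `AbelianVariety.endAlgebra.of` (Mumford §19,
"The structure of `End⁰(X)`": `End(X) ⊂ End⁰(X)` by Thm. 3). [cite: MumfordAV1970, §19 Thm. 3 and Cor. 2] -/
theorem _root_.Literature.AlgebraicGeometry.Motives.AbelianVariety.endAlgebra.of_injective_of_isIsogeny_zsmul_id
    (h₀ : isIsogeny_zsmul_id A) : Function.Injective (endAlgebra.of A) := by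
  haveI : Module.IsTorsionFree ℤ (A ⟶ A) := isTorsionFree_int_hom_of_isIsogeny_zsmul_id h₀
  -- torsion-free over the Dedekind domain `ℤ` ⟹ flat (`Mathlib.RingTheory.Flat.TorsionFree`);
  -- the instance is found on `A ⟶ A` and handed over explicitly (`End A` is not reducible).
  have hflat : Module.Flat ℤ (A ⟶ A) := inferInstance
  exact @Algebra.TensorProduct.includeRight_injective ℤ ℚ (End A) _ _ _ _ _ hflat
    (algebraMap ℤ ℚ).injective_int

/-- **In characteristic zero, `End(A) → End⁰(A)` is injective** (unconditional; Mumford §19,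
`End(X) ⊂ End⁰(X)` by Thm. 3): `End(A)` is torsion-free (`isTorsionFree_int_hom_of_charZero`),
hence flat over `ℤ`. [cite: MumfordAV1970, §19 Thm. 3 and Cor. 2] -/
theorem _root_.Literature.AlgebraicGeometry.Motives.AbelianVariety.endAlgebra.of_injective_of_charZero
    [CharZero K] : Function.Injective (endAlgebra.of A) :=
  endAlgebra.of_injective_of_isIsogeny_zsmul_id isIsogeny_zsmul_id_holds_of_charZero

/-! ### Step 3: freeness from finite generation -/

/-- **`module_free_hom` from `module_finite_hom` and `isIsogeny_zsmul_id`** (Mumford §19,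
Theorem 3 with Corollary 1; Milne 1986, Theorem 12.5: "`Hom(A, B)` is a free `ℤ`-module of finite
rank"): if `Hom(A, B)` is finitely generated (the named fact `module_finite_hom A B`) and every
`[n]_A`, `n ≠ 0`, is an isogeny (the named fact `isIsogeny_zsmul_id A`, needed only when
`char K > 0`), then `Hom(A, B)` is free — it is torsion-free by Step 1
(`isTorsionFree_int_hom_of_isIsogeny_zsmul_id`) and a finitely generated torsion-free module over
the PID `ℤ` is free (Mathlib `Module.free_of_finite_type_torsion_free'`).
[cite: MumfordAV1970, §19 Thm. 3 and Cor. 1] -/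
theorem _root_.Literature.AlgebraicGeometry.Motives.AbelianVariety.module_free_hom_of_module_finite_hom_of_isIsogeny_zsmul_id
    (h₁ : module_finite_hom A B) (h₀ : isIsogeny_zsmul_id A) : module_free_hom A B := by
  haveI : Module.Finite ℤ (A ⟶ B) := h₁
  haveI : Module.IsTorsionFree ℤ (A ⟶ B) := isTorsionFree_int_hom_of_isIsogeny_zsmul_id h₀
  change Module.Free ℤ (A ⟶ B)
  exact Module.free_of_finite_type_torsion_free'

/-- **In characteristic zero, `module_free_hom` follows from `module_finite_hom` alone**
(Mumford §19, Theorem 3 with Corollary 1; Milne 1986, Theorem 12.5): `Hom(A, B)` is torsion-free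
unconditionally (`isTorsionFree_int_hom_of_charZero`), so if it is finitely generated it is free
(Mathlib `Module.free_of_finite_type_torsion_free'`). Thus over fields of characteristic zero
the discharge of `module_free_hom` is reduced to that of `module_finite_hom`.
[cite: MumfordAV1970, §19 Thm. 3 and Cor. 1] -/
theorem _root_.Literature.AlgebraicGeometry.Motives.AbelianVariety.module_free_hom_of_module_finite_hom
    [CharZero K] (h₁ : module_finite_hom A B) : module_free_hom A B :=
  module_free_hom_of_module_finite_hom_of_isIsogeny_zsmul_id h₁ isIsogeny_zsmul_id_holds_of_charZero

/-- Conversely to nothing above but recorded for users of both facts: under `module_finite_hom A B`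
and `isIsogeny_zsmul_id A`, `Hom(A, B)` is finitely generated **and** free, i.e. `Hom(A, B) ≅ ℤ^r`
for `r = finrank_ℤ Hom(A, B)` (Mumford §19, Thm. 3 and Cor. 1; the bound `r ≤ 4 dim A dim B` is
the separate named fact `finrank_hom_le A B`). [cite: MumfordAV1970, §19 Thm. 3 and Cor. 1] -/
theorem _root_.Literature.AlgebraicGeometry.Motives.AbelianVariety.nonempty_linearEquiv_finrank_of_module_finite_hom
    (h₁ : module_finite_hom A B) (h₀ : isIsogeny_zsmul_id A) :
    Nonempty ((A ⟶ B) ≃ₗ[ℤ] (Fin (Module.finrank ℤ (A ⟶ B)) → ℤ)) := by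
  haveI : Module.Finite ℤ (A ⟶ B) := h₁
  haveI : Module.Free ℤ (A ⟶ B) :=
    module_free_hom_of_module_finite_hom_of_isIsogeny_zsmul_id h₁ h₀
  exact ⟨Module.finBasis ℤ (A ⟶ B) |>.equivFun⟩

end AbelianVariety

end Literature.NumberTheory.DiophantineGeometry

end
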